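import Summits.BirchSwinnertonDyer.BirchSwinnertonDyer.Theorems.ByReductionTypeAtTwoAdditivePotGoodPrintZhaiIrreducibleUnramified
import Summits.BirchSwinnertonDyer.BirchSwinnertonDyer.Theorems.Rank2ObservatoryTateDeepCert
import Literature.NumberTheory.EllipticCurves.KrizLi2019.TwoPartBSDTwists
import Literature.NumberTheory.EllipticCurves.HeegnerHypothesisKroneckerProofs
import Literature.NumberTheory.EllipticCurves.NeronComponentDataProofs
import Literature.NumberTheory.EllipticCurves.TamagawaRingEquivProofs
import Literature.NumberTheory.QuadraticFields.KroneckerSplitting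
import HarnessLib

/-!
# K4 crux `AdditiveRankZeroAtTwo` (19098), children C3″ (22617) / C1″ (22615): KERNEL data of the Kriz–Li base `44a1 = [0,1,0,3,−1]`
# over `K = ℚ(√−7)` — Tate certificate `IV*` at `2` (`f₂ = 2`, `c₂ ∣ 3` odd), `N = 44` EXACTLY, the partner `44a1^{(−7)} =
# [0,−7,0,147,343]` (global minimal, `IV*` at `2`, `I₀*` at `7`, `I₁` at `11`: `N = 2156 < 5000`), the Heegner hypothesis for
# `(44, d_K = −7)`, the index set `𝒩(44a1, K)` from congruences, the witness `a₂₃(44a1) = −3` odd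

Cell `bsd-2adic`, seat `bsd-2adic-k4-w2` GEN 7 (prover, explicit unit, no kit); `--supports stmt-BirchSwinnertonDyer-22617 --as helper`;
companion of the generic road `…AdditivePotGoodPrintKrizLi.lean` and GEN 6's base section `44A1` (`…PrintZhaiIrreducibleUnramified.lean`:
ellipticity, minimality, `Δ = −2816`, `E[2]` irreducible, `Addv` at `2`, `ord₂ j = 13`, non-CM, `N ∣ 2816`). HONEST FRAMING (D-0036/D-0054):
kernel theorems only (0 `def`, 0 `sorry`, no named fact): everything Kriz–Li 2019 Thm 5.1 (2) needs about the row `44a1 | −7 | 3 | ✓` of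
their Table 2 EXCEPT Assumption (★) and the optimal parametrisation (print: `KrizLi2019.table2_row44a1`; Agashe–Ribet–Stein for the odd
Manin constant) and EXCEPT `BSD(44a1, 2)`, `BSD(44a1^{(−7)}, 2)` (print: Creutz–Miller, conductors `44`, `2156 < 5000` — certified HERE).
The Tate certificates are the b2b cell's kernel engine (`Rank2Observatory.Tate.DeepCert`, Steps 6–10, hypothesis-free under `v(Δ) < 12`).
Closes nothing; nothing booked; BSD is not proved by any of this.

CONTENTS. §1 `44a1` at `2`: `IV*`, `f₂ = 2`, `c₂ ∣ 3` (odd); `f₁₁ = 1`; `N(44a1) = 44`. §2 the partner `T = [0,−7,0,147,343] = 44a1^{(−7)}`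
(definitionally the tree's `quadraticTwist (−7)`): elliptic, global minimal, `f₂ = 2` (`IV*`), `f₇ = 2` (`I₀*`), `f₁₁ = 1`, `N(T) = 2156`.
§3 the Heegner field: every quadratic `K` with `d_K = −7` satisfies the Heegner hypothesis for `N(44a1)` (`2`, `11` split); `E(ℚ)[2] = 0`
in Kriz–Li's shape; `ℓ ∈ 𝒮` / `d ∈ 𝒩` from explicit congruences; the witness `ℓ = 23` (`a₂₃ = −3` odd, `(−7/23) = 1`), `d = −23 ∈ 𝒩`,
`χ_{−23}(−44) = 1`.

References: [KrizLi2019] Thm 5.1 (2), Def 4.1, §6 Table 2 (row 44a1); [Silverman1994] IV.9.4 (Tate's algorithm), IV.11.1 (Ogg);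
[SilvermanAEC2009] VII.1, VII.3.1; [CremonaAlgorithms1997] Table 1 (44A1: `N = 44`, `IV*, I₁`, `c_p = (3, 1)`); [Marcus1977] Ch. 3 Thm. 25.
-/

set_option autoImplicit false
-- the Theorems namespace of this sub repeats the summit name by design (D-0017 nested layout)
set_option linter.dupNamespace false

noncomputable section

open scoped Classical NumberField

open WeierstrassCurve IsDedekindDomain Rat.HeightOneSpectrum Literature.NumberTheory.EllipticCurves
  Literature.NumberTheory.EllipticCurves.ModularForms
  Literature.NumberTheory.EllipticCurves.Rank1Residual
  Literature.NumberTheory.DiophantineGeometry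
  Summit.BirchSwinnertonDyer
  Summit.BirchSwinnertonDyer.Rank1Residual
  Summit.BirchSwinnertonDyer.Rank1Residual.X11b
  Summit.BirchSwinnertonDyer.Rank1Residual.X5.O1
  Summit.BirchSwinnertonDyer.Rank1Residual.P2
  Summit.BirchSwinnertonDyer.BirchSwinnertonDyer.Rank1Residual.IntModel
  Summit.BirchSwinnertonDyer.BirchSwinnertonDyer.Theorems
  Summit.BirchSwinnertonDyer.BirchSwinnertonDyer.Rank2Observatory.Tate

namespace Summit.BirchSwinnertonDyer.BirchSwinnertonDyer.Theorems.AddPotGoodPrint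

/-! ## §1 `44a1` at `2` and `11`: Tate certificate `IV*`, `f₂ = 2`, `c₂ ∣ 3`, `f₁₁ = 1`, `N = 44` -/
section Base44A1Local

/-- The integer model of `44a1` base-changed to `ℚ` is the rational model. [folklore] -/
theorem baseChange_int_44A1 : (⟨0, 1, 0, 3, -1⟩ : WeierstrassCurve ℤ).baseChange ℚ = (⟨0, 1, 0, 3, -1⟩ : WeierstrassCurve ℚ) := by
  ext <;> simp [WeierstrassCurve.baseChange, WeierstrassCurve.map]

/-- **Tate certificate for `44a1` at `2`, kernel check**: on the translated model `(r,s,t) = (1,0,2)`, i.e. `[0,4,4,8,0]`: `2 ∣ a₁`,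
`4 ∣ a₂, a₃`, `8 ∣ a₄`, `16 ∣ a₆`, `2 ∤ (a₃/4)² + 4·a₆/16 = 1` — exit of Step 8, type `IV*`, `v₂(Δ) = 8`. [cite: Silverman1994, IV.9.4 Step 8] -/
theorem tateDeepCheck_two_44A1 : DeepCert.check ⟨2, 1, 0, 2, 8, 8, 0⟩ ⟨0, 1, 0, 3, -1⟩ = true := by
  decide +kernel

/-- **`44a1` has Kodaira type `IV*` and `ord₂ Δ_min = 8` at the place above `2`** (hypothesis-free: `v₂(Δ) = 8 < 12`).
[cite: Silverman1994, IV.9.4 Step 8] [cite: CremonaAlgorithms1997, Table 1 (44A1: IV*)] -/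
theorem kodairaSymbolAt_two_44A1 (v : HeightOneSpectrum (𝓞 ℚ)) (hv : natGenerator v = 2) :
    (⟨0, 1, 0, 3, -1⟩ : WeierstrassCurve ℚ).kodairaSymbolAt v = .IVstar ∧
      (⟨0, 1, 0, 3, -1⟩ : WeierstrassCurve ℚ).ordMinimalDiscriminant v = 8 := by
  have h := DeepCert.sound' (W₀ := ⟨0, 1, 0, 3, -1⟩) (c := ⟨2, 1, 0, 2, 8, 8, 0⟩) v hv tateDeepCheck_two_44A1 (by decide +kernel)
  rw [baseChange_int_44A1] at h
  exact h

/-- **`f₂(44a1) = 2`** (Ogg: `8 + 1 − 7` components of `IV*`), hypothesis-free. [cite: Silverman1994, IV.11.1] -/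
theorem conductorExponent_two_44A1 (v : HeightOneSpectrum ℤ) (hv : natGenerator v = 2) :
    (⟨0, 1, 0, 3, -1⟩ : WeierstrassCurve ℚ).conductorExponent v = 2 := by
  have h := DeepCert.conductorExponent_int_eq' (W₀ := ⟨0, 1, 0, 3, -1⟩) (c := ⟨2, 1, 0, 2, 8, 8, 0⟩) v hv tateDeepCheck_two_44A1
    (by decide +kernel)
  rw [baseChange_int_44A1] at h
  exact h

/-- **`ord₂ N(44a1) = 2`.** [cite: Silverman1994, IV.11.1] [cite: CremonaAlgorithms1997, Table 1 (44A1: N = 2²·11)] -/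
theorem factorization_conductorNorm_two_44A1 :
    haveI := isElliptic_44A1
    ((⟨0, 1, 0, 3, -1⟩ : WeierstrassCurve ℚ).conductorNorm ℤ).factorization 2 = 2 := by
  haveI := isElliptic_44A1
  rw [show (2 : ℕ) = ((⟨2, Nat.prime_two⟩ : Nat.Primes) : ℕ) from rfl, factorization_conductorNorm_primesEquiv_symm]
  exact conductorExponent_two_44A1 _ (congrArg Subtype.val ((primesEquiv (R := ℤ)).apply_symm_apply ⟨2, Nat.prime_two⟩))

/-- **`ord₁₁ N(44a1) = 1`** (`44a1` is multiplicative at `11`: `11 ∣ Δ`, `11 ∤ c₄`). [cite: BombieriGubler2006, 12.5.9(b)] -/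
theorem factorization_conductorNorm_eleven_44A1 :
    haveI := isElliptic_44A1
    ((⟨0, 1, 0, 3, -1⟩ : WeierstrassCurve ℚ).conductorNorm ℤ).factorization 11 = 1 := by
  haveI := isElliptic_44A1; haveI := isGloballyMinimal_44A1
  haveI hE : ((⟨0, 1, 0, 3, -1⟩ : WeierstrassCurve ℤ).baseChange ℚ).IsElliptic := by rw [baseChange_int_44A1]; infer_instance
  have h11 : Nat.Prime 11 := by norm_num
  set v : HeightOneSpectrum ℤ := (primesEquiv (R := ℤ)).symm ⟨11, h11⟩ with hv
  have hgen : natGenerator v = 11 := congrArg Subtype.val ((primesEquiv (R := ℤ)).apply_symm_apply ⟨11, h11⟩)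
  have hmin : ((⟨0, 1, 0, 3, -1⟩ : WeierstrassCurve ℤ).baseChange ℚ).IsMinimalAt v := by
    rw [baseChange_int_44A1]; exact IsGloballyMinimal.isMinimalAt_int _ v
  have h1 : ((⟨0, 1, 0, 3, -1⟩ : WeierstrassCurve ℤ).baseChange ℚ).conductorExponent v = 1 :=
    conductorExponent_eq_one_of_dvd_Δ_of_not_dvd_c₄ hmin (by rw [hgen, M44A1_Δ]; decide) (by rw [hgen, M44A1_c₄]; decide)
  rw [baseChange_int_44A1] at h1
  rw [show (11 : ℕ) = ((⟨11, h11⟩ : Nat.Primes) : ℕ) from rfl, factorization_conductorNorm_primesEquiv_symm]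
  exact h1

/-- A natural number whose only possible prime factors are `2` and `11` has `q`-exponent `0` at every other `q`. [folklore] -/
theorem factorization_eq_zero_of_two_pow_mul_eleven (a : ℕ) {q : ℕ} (hq2 : q ≠ 2) (hq11 : q ≠ 11) :
    (2 ^ a * 11).factorization q = 0 := by
  by_cases hq : q.Prime
  · refine Nat.factorization_eq_zero_of_not_dvd fun h => ?_
    rcases (Nat.Prime.dvd_mul hq).mp h with h | h
    · exact hq2 ((Nat.prime_dvd_prime_iff_eq hq Nat.prime_two).mp (hq.dvd_of_dvd_pow h))
    · exact hq11 ((Nat.prime_dvd_prime_iff_eq hq (by norm_num)).mp h)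
  · exact Nat.factorization_eq_zero_of_not_prime _ hq

/-- **`N(44a1) = 44` IN THE KERNEL** (`N ∣ 2⁸·11`, `ord₂ N = 2`, `ord₁₁ N = 1`). [cite: CremonaAlgorithms1997, Table 1 (44A1)] -/
theorem conductorNorm_44A1 :
    haveI := isElliptic_44A1
    (⟨0, 1, 0, 3, -1⟩ : WeierstrassCurve ℚ).conductorNorm ℤ = 44 := by
  haveI := isElliptic_44A1
  set N := (⟨0, 1, 0, 3, -1⟩ : WeierstrassCurve ℚ).conductorNorm ℤ with hN
  have hN0 : N ≠ 0 := (conductorNorm_pos_holds _).ne'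
  have hle := (Nat.factorization_le_iff_dvd hN0 (by norm_num : (2816 : ℕ) ≠ 0)).mpr conductorNorm_dvd_44A1
  refine Nat.eq_of_factorization_eq hN0 (by norm_num) fun q => ?_
  by_cases hq2 : q = 2
  · subst hq2
    rw [factorization_conductorNorm_two_44A1, show (44 : ℕ) = 2 ^ 2 * 11 by norm_num,
      Nat.factorization_mul (by norm_num) (by norm_num), Finsupp.add_apply, Nat.Prime.factorization_pow Nat.prime_two,
      Finsupp.single_eq_same, Nat.factorization_eq_zero_of_not_dvd (by norm_num)]
  by_cases hq11 : q = 11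
  · subst hq11
    rw [factorization_conductorNorm_eleven_44A1, show (44 : ℕ) = 2 ^ 2 * 11 by norm_num,
      Nat.factorization_mul (by norm_num) (by norm_num), Finsupp.add_apply, Nat.Prime.factorization_pow Nat.prime_two,
      Finsupp.single_eq_of_ne (by norm_num), Nat.Prime.factorization_self (by norm_num)]
  · have hq' := hle q
    rw [show (2816 : ℕ) = 2 ^ 8 * 11 by norm_num, factorization_eq_zero_of_two_pow_mul_eleven 8 hq2 hq11] at hq'
    rw [show (44 : ℕ) = 2 ^ 2 * 11 by norm_num, factorization_eq_zero_of_two_pow_mul_eleven 2 hq2 hq11]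
    exact Nat.le_zero.mp hq'

/-- **`N(44a1) < 5000`** (Creutz–Miller's range) — already from `N ∣ 2816`. [cite: CreutzMiller2012, Thm. 1.1] -/
theorem conductorNorm_lt_5000_44A1 :
    haveI := isElliptic_44A1
    (⟨0, 1, 0, 3, -1⟩ : WeierstrassCurve ℚ).conductorNorm ℤ < 5000 := by
  rw [conductorNorm_44A1]; norm_num

/-- `N(44a1) ≠ 0` as an instance-free fact for the parametrisation level. [folklore] -/
theorem neZero_conductorNorm_44A1 :
    haveI := isElliptic_44A1
    NeZero ((⟨0, 1, 0, 3, -1⟩ : WeierstrassCurve ℚ).conductorNorm ℤ) :=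
  haveI := isElliptic_44A1
  ⟨(conductorNorm_pos_holds _).ne'⟩

/-- **`c₂(44a1)` is ODD** (Kriz–Li's hypothesis «`c₂(E)` odd»; Cremona: `c₂ = 3`): the local Tamagawa number divides the order `3` of the
geometric component group of type `IV*`. Read on the `ℚ₂`-model of Kriz–Li's statement via the tree's `ℚ_p`/adèlic bridge.
[cite: KrizLi2019, Thm. 5.1 (hypothesis "c₂(E) odd") and Table 2 (row 44a1: c₂ = 3)] [cite: Silverman1994, IV.9 Table 4.1 and Cor. 9.2] -/
theorem odd_localTamagawaNumber_two_44A1 :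
    haveI := isElliptic_44A1; haveI : Fact (Nat.Prime 2) := ⟨Nat.prime_two⟩
    Odd (((⟨0, 1, 0, 3, -1⟩ : WeierstrassCurve ℚ).baseChange ℚ_[2]).localTamagawaNumber ℤ_[2]) := by
  haveI := isElliptic_44A1
  haveI : Fact (Nat.Prime 2) := ⟨Nat.prime_two⟩
  set v : HeightOneSpectrum (𝓞 ℚ) := (primesEquiv (R := 𝓞 ℚ)).symm ⟨2, Nat.prime_two⟩ with hv
  have hv2 : (primesEquiv v : ℕ) = 2 := by rw [hv, Equiv.apply_symm_apply]
  have hgen : natGenerator v = 2 := hv2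
  rw [localTamagawaNumber_padic_eq_holds (⟨0, 1, 0, 3, -1⟩ : WeierstrassCurve ℚ) v 2 hv2]
  have hdvd := localTamagawaNumber_dvd_componentGroupOrder v (⟨0, 1, 0, 3, -1⟩ : WeierstrassCurve ℚ)
    (nonempty_neronComponentData_holds _ v)
  rw [(kodairaSymbolAt_two_44A1 v hgen).1] at hdvd
  change _ ∣ 3 at hdvd
  rcases (Nat.dvd_prime Nat.prime_three).mp hdvd with h | h
  · rw [h]; exact odd_one
  · rw [h]; exact ⟨1, rfl⟩

end Base44A1Local

/-! ## §2 The partner `T = 44a1^{(−7)} = [0,−7,0,147,343]`: global minimal, `N(T) = 2²·7²·11 = 2156 < 5000` -/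
section Partner44A1

/-- **The tree's quadratic twist `44a1^{(−7)}` IS `[0,−7,0,147,343]`** (`quadraticTwist d = [0, d·b₂/4, 0, d²·b₄/2, d³·b₆/4]`,
`(b₂, b₄, b₆) = (4, 6, −4)`). [cite: SilvermanAEC2009, X.5 Cor. 5.4] -/
theorem quadraticTwist_neg7_44A1 :
    (⟨0, 1, 0, 3, -1⟩ : WeierstrassCurve ℚ).quadraticTwist (-7) = (⟨0, -7, 0, 147, 343⟩ : WeierstrassCurve ℚ) := by
  ext <;> norm_num [WeierstrassCurve.quadraticTwist, WeierstrassCurve.b₂, WeierstrassCurve.b₄, WeierstrassCurve.b₆]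

/-- `T = [0,−7,0,147,343]` is an elliptic curve (`Δ = −2⁸·7⁶·11 ≠ 0`). [cite: SilvermanAEC2009, III.1] -/
theorem isElliptic_T44A1 : (⟨0, -7, 0, 147, 343⟩ : WeierstrassCurve ℚ).IsElliptic := ⟨by
  rw [isUnit_iff_ne_zero]; norm_num [WeierstrassCurve.Δ, WeierstrassCurve.b₂, WeierstrassCurve.b₄, WeierstrassCurve.b₆, WeierstrassCurve.b₈]⟩

/-- **`T` is GLOBALLY MINIMAL** (`|Δ| = 2⁸·7⁶·11`: `v_p Δ < 12` everywhere). [cite: SilvermanAEC2009, VII.1 Remark 1.1] [cite: Kraus1989, Prop. 1] -/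
theorem isGloballyMinimal_T44A1 : (⟨0, -7, 0, 147, 343⟩ : WeierstrassCurve ℚ).IsGloballyMinimal :=
  isGloballyMinimal_of_krausCriterion_support (0) (-7) (0) (147) (343) [(2, 0, 8), (7, 0, 6), (11, 0, 1)]
    (by intro t ht; simp only [List.mem_cons, List.not_mem_nil, or_false] at ht
        rcases ht with rfl | rfl | rfl <;> norm_num)
    (by decide +kernel) (by decide +kernel)

/-- `Δ(T) = −331299584 = −2⁸·7⁶·11` (integer model). [cite: SilvermanAEC2009, III.1] -/
theorem MT44A1_Δ : (⟨0, -7, 0, 147, 343⟩ : WeierstrassCurve ℤ).Δ = -331299584 := by decide +kernel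
/-- `c₄(T) = −6272 = −2⁷·7²` (integer model). [cite: SilvermanAEC2009, III.1] -/
theorem MT44A1_c₄ : (⟨0, -7, 0, 147, 343⟩ : WeierstrassCurve ℤ).c₄ = -6272 := by decide +kernel

/-- The integer model of `T` base-changed to `ℚ`. [folklore] -/
theorem baseChange_int_T44A1 : (⟨0, -7, 0, 147, 343⟩ : WeierstrassCurve ℤ).baseChange ℚ = (⟨0, -7, 0, 147, 343⟩ : WeierstrassCurve ℚ) := by
  ext <;> simp [WeierstrassCurve.baseChange, WeierstrassCurve.map]

/-- The integer model of `T` is its `integralModelInt`. [cite: SilvermanAEC2009, VIII.8] -/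
theorem intModel_T44A1 :
    haveI := isElliptic_T44A1; haveI := isGloballyMinimal_T44A1
    integralModelInt (⟨0, -7, 0, 147, 343⟩ : WeierstrassCurve ℚ) = (⟨0, -7, 0, 147, 343⟩ : WeierstrassCurve ℤ) :=
  haveI := isElliptic_T44A1; haveI := isGloballyMinimal_T44A1
  integralModelInt_eq_of_map_eq _ (by ext <;> simp [WeierstrassCurve.map])

/-- **`N(T) ∣ |Δ_min(T)| = 2⁸·7⁶·11`.** [cite: SilvermanAEC2009, VIII.11 and C.16] -/
theorem conductorNorm_dvd_T44A1 :
    haveI := isElliptic_T44A1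
    (⟨0, -7, 0, 147, 343⟩ : WeierstrassCurve ℚ).conductorNorm ℤ ∣ 331299584 := by
  haveI := isElliptic_T44A1; haveI := isGloballyMinimal_T44A1
  have hdvd := WeierstrassCurve.conductorNorm_dvd_minimalDiscriminantNorm (⟨0, -7, 0, 147, 343⟩ : WeierstrassCurve ℚ)
    (WeierstrassCurve.finite_setOf_ordMinimalDiscriminant_ne_zero_holds _)
  rw [WeierstrassCurve.minimalDiscriminantNorm_int_eq_natAbs_minimalDiscriminantInt_holds,
    minimalDiscriminantInt_eq intModel_T44A1, MT44A1_Δ] at hdvd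
  exact hdvd

/-- **Tate certificate for `T` at `2`**: `(r,s,t) = (1,0,2)` gives `[0,−4,4,136,480]`, exit Step 8 (`(4/4)² + 4·480/16 = 121` odd),
type `IV*`, `v₂(Δ) = 8` (the unramified twist `−7 ≡ 1 (mod 8)` does not change the type). [cite: Silverman1994, IV.9.4 Step 8] -/
theorem tateDeepCheck_two_T44A1 : DeepCert.check ⟨2, 1, 0, 2, 8, 8, 0⟩ ⟨0, -7, 0, 147, 343⟩ = true := by
  decide +kernel

/-- **Tate certificate for `T` at `7`**: on the model itself, `7 ∣ a₂`, `49 ∣ a₃, a₄`, `343 ∣ a₆` and the cubic `X³ − X² + 3X + 1`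
(`(a₂/7, a₄/49, a₆/343) = (−1, 3, 1)`) has discriminant `−176`, prime to `7` — exit Step 6, type `I₀*`, `v₇(Δ) = 6`.
[cite: Silverman1994, IV.9.4 Step 6] -/
theorem tateDeepCheck_seven_T44A1 : DeepCert.check ⟨7, 0, 0, 0, 6, 6, 0⟩ ⟨0, -7, 0, 147, 343⟩ = true := by
  decide +kernel

/-- **`f₂(T) = 2`** (type `IV*`, `v₂(Δ) = 8`), hypothesis-free. [cite: Silverman1994, IV.11.1] -/
theorem conductorExponent_two_T44A1 (v : HeightOneSpectrum ℤ) (hv : natGenerator v = 2) :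
    (⟨0, -7, 0, 147, 343⟩ : WeierstrassCurve ℚ).conductorExponent v = 2 := by
  have h := DeepCert.conductorExponent_int_eq' (W₀ := ⟨0, -7, 0, 147, 343⟩) (c := ⟨2, 1, 0, 2, 8, 8, 0⟩) v hv
    tateDeepCheck_two_T44A1 (by decide +kernel)
  rw [baseChange_int_T44A1] at h
  exact h

/-- **`f₇(T) = 2`** (type `I₀*`, `v₇(Δ) = 6`: `6 + 1 − 5`), hypothesis-free. [cite: Silverman1994, IV.11.1] -/
theorem conductorExponent_seven_T44A1 (v : HeightOneSpectrum ℤ) (hv : natGenerator v = 7) :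
    (⟨0, -7, 0, 147, 343⟩ : WeierstrassCurve ℚ).conductorExponent v = 2 := by
  have h := DeepCert.conductorExponent_int_eq' (W₀ := ⟨0, -7, 0, 147, 343⟩) (c := ⟨7, 0, 0, 0, 6, 6, 0⟩) v hv
    tateDeepCheck_seven_T44A1 (by decide +kernel)
  rw [baseChange_int_T44A1] at h
  exact h

/-- **`ord₂ N(T) = 2`, `ord₇ N(T) = 2`, `ord₁₁ N(T) = 1`** (the last: multiplicative at `11`, `11 ∣ Δ`, `11 ∤ c₄`).
[cite: Silverman1994, IV.11.1] [cite: BombieriGubler2006, 12.5.9(b)] -/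
theorem factorization_conductorNorm_T44A1 :
    haveI := isElliptic_T44A1
    ((⟨0, -7, 0, 147, 343⟩ : WeierstrassCurve ℚ).conductorNorm ℤ).factorization 2 = 2 ∧
      ((⟨0, -7, 0, 147, 343⟩ : WeierstrassCurve ℚ).conductorNorm ℤ).factorization 7 = 2 ∧
        ((⟨0, -7, 0, 147, 343⟩ : WeierstrassCurve ℚ).conductorNorm ℤ).factorization 11 = 1 := by
  haveI := isElliptic_T44A1; haveI := isGloballyMinimal_T44A1
  haveI hE : ((⟨0, -7, 0, 147, 343⟩ : WeierstrassCurve ℤ).baseChange ℚ).IsElliptic := by rw [baseChange_int_T44A1]; infer_instance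
  have h7 : Nat.Prime 7 := by norm_num
  have h11 : Nat.Prime 11 := by norm_num
  refine ⟨?_, ?_, ?_⟩
  · rw [show (2 : ℕ) = ((⟨2, Nat.prime_two⟩ : Nat.Primes) : ℕ) from rfl, factorization_conductorNorm_primesEquiv_symm]
    exact conductorExponent_two_T44A1 _ (congrArg Subtype.val ((primesEquiv (R := ℤ)).apply_symm_apply ⟨2, Nat.prime_two⟩))
  · rw [show (7 : ℕ) = ((⟨7, h7⟩ : Nat.Primes) : ℕ) from rfl, factorization_conductorNorm_primesEquiv_symm]
    exact conductorExponent_seven_T44A1 _ (congrArg Subtype.val ((primesEquiv (R := ℤ)).apply_symm_apply ⟨7, h7⟩))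
  · set v : HeightOneSpectrum ℤ := (primesEquiv (R := ℤ)).symm ⟨11, h11⟩ with hv
    have hgen : natGenerator v = 11 := congrArg Subtype.val ((primesEquiv (R := ℤ)).apply_symm_apply ⟨11, h11⟩)
    have hmin : ((⟨0, -7, 0, 147, 343⟩ : WeierstrassCurve ℤ).baseChange ℚ).IsMinimalAt v := by
      rw [baseChange_int_T44A1]; exact IsGloballyMinimal.isMinimalAt_int _ v
    have h1 : ((⟨0, -7, 0, 147, 343⟩ : WeierstrassCurve ℤ).baseChange ℚ).conductorExponent v = 1 :=
      conductorExponent_eq_one_of_dvd_Δ_of_not_dvd_c₄ hmin (by rw [hgen, MT44A1_Δ]; decide) (by rw [hgen, MT44A1_c₄]; decide)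
    rw [baseChange_int_T44A1] at h1
    rw [show (11 : ℕ) = ((⟨11, h11⟩ : Nat.Primes) : ℕ) from rfl, factorization_conductorNorm_primesEquiv_symm]
    exact h1

/-- A natural number whose only possible prime factors are `2`, `7`, `11` has `q`-exponent `0` at every other `q`. [folklore] -/
theorem factorization_eq_zero_of_two_seven_eleven (a b c : ℕ) {q : ℕ} (hq2 : q ≠ 2) (hq7 : q ≠ 7) (hq11 : q ≠ 11) :
    (2 ^ a * 7 ^ b * 11 ^ c).factorization q = 0 := by
  by_cases hq : q.Prime
  · refine Nat.factorization_eq_zero_of_not_dvd fun h => ?_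
    rcases (Nat.Prime.dvd_mul hq).mp h with h | h
    · rcases (Nat.Prime.dvd_mul hq).mp h with h | h
      · exact hq2 ((Nat.prime_dvd_prime_iff_eq hq Nat.prime_two).mp (hq.dvd_of_dvd_pow h))
      · exact hq7 ((Nat.prime_dvd_prime_iff_eq hq (by norm_num)).mp (hq.dvd_of_dvd_pow h))
    · exact hq11 ((Nat.prime_dvd_prime_iff_eq hq (by norm_num)).mp (hq.dvd_of_dvd_pow h))
  · exact Nat.factorization_eq_zero_of_not_prime _ hq

/-- **`N(44a1^{(−7)}) = 2156 = 2²·7²·11` IN THE KERNEL.** [cite: Silverman1994, IV.11.1] [cite: CremonaAlgorithms1997, Table 1 (2156)] -/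
theorem conductorNorm_T44A1 :
    haveI := isElliptic_T44A1
    (⟨0, -7, 0, 147, 343⟩ : WeierstrassCurve ℚ).conductorNorm ℤ = 2156 := by
  haveI := isElliptic_T44A1
  set N := (⟨0, -7, 0, 147, 343⟩ : WeierstrassCurve ℚ).conductorNorm ℤ with hN
  have hN0 : N ≠ 0 := (conductorNorm_pos_holds _).ne'
  have hle := (Nat.factorization_le_iff_dvd hN0 (by norm_num : (331299584 : ℕ) ≠ 0)).mpr conductorNorm_dvd_T44A1
  obtain ⟨h2, h7, h11⟩ := factorization_conductorNorm_T44A1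
  have e2156 : (2156 : ℕ) = 2 ^ 2 * 7 ^ 2 * 11 ^ 1 := by norm_num
  have eΔ : (331299584 : ℕ) = 2 ^ 8 * 7 ^ 6 * 11 ^ 1 := by norm_num
  refine Nat.eq_of_factorization_eq hN0 (by norm_num) fun q => ?_
  by_cases hq2 : q = 2
  · subst hq2; rw [h2, e2156]; decide +kernel
  by_cases hq7 : q = 7
  · subst hq7; rw [h7, e2156]; decide +kernel
  by_cases hq11 : q = 11
  · subst hq11; rw [h11, e2156]; decide +kernel
  · have hq' := hle q
    rw [eΔ, factorization_eq_zero_of_two_seven_eleven 8 6 1 hq2 hq7 hq11] at hq'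
    rw [e2156, factorization_eq_zero_of_two_seven_eleven 2 2 1 hq2 hq7 hq11]
    exact Nat.le_zero.mp hq'

/-- **`N(44a1^{(−7)}) = 2156 < 5000`** (Creutz–Miller's range for the rank-one partner). [cite: CreutzMiller2012, Thm. 1.1] -/
theorem conductorNorm_lt_5000_T44A1 :
    haveI := isElliptic_T44A1
    (⟨0, -7, 0, 147, 343⟩ : WeierstrassCurve ℚ).conductorNorm ℤ < 5000 := by
  rw [conductorNorm_T44A1]; norm_num

end Partner44A1

end Summit.BirchSwinnertonDyer.BirchSwinnertonDyer.Theorems.AddPotGoodPrint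

end
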